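import Summits.QuantumFields.QCD.Theorems.HeatSlicedQuarksSmallFieldUltracontractivityStubRowDuhamel
import Summits.QuantumFields.QCD.Theorems.HeatSlicedQuarksSmallFieldUltracontractivityStubHeatRowCalculus
import Summits.QuantumFields.QCD.Theorems.HeatSlicedQuarksSmallFieldUltracontractivityBootHopping
import Summits.QuantumFields.QCD.Theorems.HeatSlicedQuarksSmallFieldUltracontractivityFixedPointA
import Summits.QuantumFields.QCD.Theorems.HeatSlicedQuarksSmallFieldUltracontractivityFixedPointB
import Summits.QuantumFields.QCD.Theorems.HeatSlicedQuarksSmallFieldUltracontractivityFixedPointC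
import Summits.QuantumFields.QCD.Theorems.HeatSlicedQuarksSmallFieldUltracontractivityFixedPointD1
import Summits.QuantumFields.QCD.Theorems.HeatSlicedQuarksSmallFieldUltracontractivityFixedPointD2
import Summits.QuantumFields.QCD.Theorems.HeatSlicedQuarksSmallFieldUltracontractivityFixedPointD3a
import Summits.QuantumFields.QCD.Theorems.HeatSlicedQuarksDaviesGaffneyWilsonRange
import Literature.MathematicalPhysics.QuantumLattice.GrassmannIntegralWilsonProofs
import Literature.MathematicalPhysics.QuantumLattice.LatticeToriProofs
import Mathlib.Analysis.SpecialFunctions.Integrals.Basic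

/-!
# Caloric fixed point — part D3b: the main step of the bootstrap
(helpers of the line lead for `stub_caloricFixedPoint`, crux `SmallFieldUltracontractivity`,
item stmt-QuantumFields-8871, line `point-centred-axial-parabolic`)

**The main step.**  For an `SU(3)` field `U`, mass `m ∈ [-1/2, 1]`, centre `x`, time `s ≥ 4096` with
`rs = √s`, `n = ⌈rs⌉`, `N = ⌊rs/4⌋`, on a torus of side `L ≥ 1024 n`, assume the links within `torusDist ≤ 128 n`
of `x` have deficit `≤ 8κ²/s` and the HEREDITARY hypothesis: every row of `e^{-(s/8)H_U}` based within
`torusDist ≤ 64 n` of `x` has `ℓ²` norm `≤ 8B/s`.  Then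
`s · ‖row_{(x,a,α)}(e^{-sH_U})‖₂ ≤ 3 C_r + 3072 C_c + 3072 C_r (1/√c_r + 3138) · κB`,
where `C_r, c_r` are the constants of the free row bounds and `C_c` the constant of the commutator bound.
PROOF = the cut-off Duhamel parametrix of the line: `stub_rowDuhamel` with the polynomial weight
`θ(τ) = 1 − (4(s−τ)/(3s))²` on `[s/4, s]` and the product cutoff of scale `N` represents the row as
`∫_{s/4}^{s} row(F(τ)) dτ`; the row of `F(τ)` is bounded pointwise (registered form of `stub_integrandRow`)
using the free row bounds, the commutator bound, the smoothing row (`stub_smoothingRow`), the hopping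
row/column sums (`stub_hoppingRowSums`, `λ = 4κ/√s`), the monotonicity of heat rows and the `Q`-trick
(`stub_heatRowCalculus` (2),(3), hereditary hypothesis at the single time `s/8`); Minkowski by duality
(`stub_rowIntegralDuality`), the two elementary integrals (`stub_timeIntegrals`) and bookkeeping of the
constants close the estimate.  The general facts enter through their landed registered forms (`stub_rowDuhamel`, `stub_heatRowCalculus`,
`stub_rowIntegralDuality`, `stub_cutoffFacts`, `stub_timeIntegrals`, `stub_smoothingRow`, `stub_integrandRow`,
`stub_hoppingRowSums`).
-/

noncomputable section

namespace Summit.QuantumFields.QCD.Cruxes.SmallFieldUltracontractivity.PointCentredAxialParabolic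

open Literature.MathematicalPhysics.QuantumLattice Literature.MathematicalPhysics.QuantumFieldTheory
open Literature.Probability.LatticeModels (TorusSite)
open Summit.QuantumFields.QCD.Theorems.SmallFieldUltracontractivity.Negative
open Summit.QuantumFields.QCD.Theorems.HeatSlicedQuarksDaviesGaffney (wilsonDirac_apply_eq_zero)
open scoped Matrix ComplexConjugate
open MeasureTheory intervalIntegral

set_option maxHeartbeats 800000 in
-- one long assembly proof (≈ 30 `have`s over a large context); splitting it would duplicate the ~100-line setup
/-- **The main step of the caloric bootstrap** (registered stub `stub_mainStep`; see the module docstring). -/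
theorem stub_mainStep :
    ∀ {Cr cr : ℝ} (hcr : 0 < cr) (hCr : 0 ≤ Cr)
    (hFR : ∀ (L : ℕ) [NeZero L] (m : ℝ), m ∈ Set.Icc (-(1 / 2 : ℝ)) 1 → ∀ σ : ℝ, 0 ≤ σ → σ ≤ (L : ℝ) ^ 2 → ∀ (x : TorusSite 4 L) (a : Fin 3) (α : Fin 4),
      (∑ j, ‖(NormedSpace.exp (-(σ : ℂ) • ((wilsonDirac (fundamentalRep (Fin 3)) (freeCfg L) m 1)ᴴ *
      wilsonDirac (fundamentalRep (Fin 3)) (freeCfg L) m 1))) (x, a, α) j‖ ^ 2 ≤ (Cr / (1 + σ)) ^ 2) ∧ (∑ j, ‖(NormedSpace.exp (-(σ : ℂ) •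
      ((wilsonDirac (fundamentalRep (Fin 3)) (freeCfg L) m 1)ᴴ * wilsonDirac (fundamentalRep (Fin 3)) (freeCfg L) m 1))) (x, a, α) j‖ ≤ Cr * Real.exp (-(cr * σ * m ^ 2))) ∧
      ∀ μ : Fin 4, ∑ z : TorusSite 4 L, ∑ b : Fin 3, ∑ β : Fin 4, ‖(NormedSpace.exp (-(σ : ℂ) • ((wilsonDirac (fundamentalRep (Fin 3)) (freeCfg L) m 1)ᴴ *
      wilsonDirac (fundamentalRep (Fin 3)) (freeCfg L) m 1))) (x, a, α) (z, b, β) - (NormedSpace.exp (-(σ : ℂ) • ((wilsonDirac (fundamentalRep (Fin 3)) (freeCfg L) m 1)ᴴ *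
      wilsonDirac (fundamentalRep (Fin 3)) (freeCfg L) m 1))) (x, a, α) (Site.shift z μ, b, β)‖ ≤ Cr * Real.exp (-(cr * σ * m ^ 2)) / Real.sqrt (1 + σ))
    {Cc : ℝ} (hCc : 0 ≤ Cc)
    (hComm : ∀ (L : ℕ) [NeZero L] (m : ℝ), m ∈ Set.Icc (-(1 / 2 : ℝ)) 1 → ∀ σ : ℝ, 0 ≤ σ → σ ≤ (L : ℝ) ^ 2 → ∀ (x : TorusSite 4 L) (a : Fin 3) (α : Fin 4) (N : ℕ),
      8 ≤ N → 4 * N + 8 ≤ L → ∑ j, ‖(NormedSpace.exp (-(σ : ℂ) • ((wilsonDirac (fundamentalRep (Fin 3)) (freeCfg L) m 1)ᴴ *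
      wilsonDirac (fundamentalRep (Fin 3)) (freeCfg L) m 1)) * (((wilsonDirac (fundamentalRep (Fin 3)) (freeCfg L) m 1)ᴴ *
      wilsonDirac (fundamentalRep (Fin 3)) (freeCfg L) m 1) *
      Matrix.diagonal (fun j : TorusSite 4 L × Fin 3 × Fin 4 => (((∏ ν : Fin 4, (max 0 (1 - (max 0 ((min ((j.1 - x) ν).val (L - ((j.1 - x) ν).val) : ℝ) / (N : ℝ) - 1)) ^ 2)) ^ 2) : ℝ) : ℂ)) -
      Matrix.diagonal (fun j : TorusSite 4 L × Fin 3 × Fin 4 => (((∏ ν : Fin 4, (max 0 (1 - (max 0 ((min ((j.1 - x) ν).val (L - ((j.1 - x) ν).val) : ℝ) / (N : ℝ) - 1)) ^ 2)) ^ 2) : ℝ) : ℂ)) *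
      ((wilsonDirac (fundamentalRep (Fin 3)) (freeCfg L) m 1)ᴴ * wilsonDirac (fundamentalRep (Fin 3)) (freeCfg L) m 1))) (x, a, α) j‖ ^ 2 ≤ (Cc / (N : ℝ) ^ 4) ^ 2)
    {L : ℕ} [NeZero L] (U : GaugeConfig 4 L SU3) {m : ℝ} (hm : m ∈ Set.Icc (-(1 / 2 : ℝ)) 1) (x : TorusSite 4 L) (a : Fin 3) (α : Fin 4) {s κ B : ℝ} (hκ : 0 < κ) (hB : 0 ≤ B)
    (hs : (4096 : ℝ) ≤ s) (hL : 1024 * ⌈Real.sqrt s⌉₊ ≤ L)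
    (hflat : ∀ z : TorusSite 4 L, torusDist x z ≤ 128 * ⌈Real.sqrt s⌉₊ → ∀ μ : Fin 4, 3 - ((fundamentalRep (Fin 3)) (U (z, μ))).trace.re ≤ 8 * κ ^ 2 / s)
    (hher : ∀ (z : TorusSite 4 L) (b : Fin 3) (β : Fin 4), torusDist x z ≤ 64 * ⌈Real.sqrt s⌉₊ →
      Real.sqrt (∑ j, ‖(NormedSpace.exp (-((s / 8 : ℝ) : ℂ) • ((wilsonDirac (fundamentalRep (Fin 3)) U m 1)ᴴ * wilsonDirac (fundamentalRep (Fin 3)) U m 1))) (z, b, β) j‖ ^ 2) ≤ 8 * B / s),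
    s * Real.sqrt (∑ j, ‖(NormedSpace.exp (-(s : ℂ) • ((wilsonDirac (fundamentalRep (Fin 3)) U m 1)ᴴ * wilsonDirac (fundamentalRep (Fin 3)) U m 1))) (x, a, α) j‖ ^ 2) ≤
    3 * Cr + 3072 * Cc + 3072 * Cr * (1 / Real.sqrt cr + 3138) * (κ * B) := by
  intro Cr cr hcr hCr hFR Cc hCc hComm L _ U m hm x a α s κ B hκ hB hs hL hflat hher
  -- the landed general facts of the line, in their registered forms
  have hDuh := @stub_rowDuhamel
  have hRow := stub_heatRowCalculus
  have hDual := @stub_rowIntegralDuality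
  have hCut := @stub_cutoffFacts
  have hInt := stub_timeIntegrals
  have hSmooth := @stub_smoothingRow
  have hIntegrand := @stub_integrandRow
  have hHop := @stub_hoppingRowSums
  classical
  /- ───── scales ───── -/
  obtain ⟨hs0, hrs, hsq, hceil, hceil', hfloor, hN8, hN16, h4N, hn64⟩ := scale_facts hs
  set rs : ℝ := Real.sqrt s with hrs_def
  set n : ℕ := ⌈Real.sqrt s⌉₊ with hn_def
  set N : ℕ := ⌊Real.sqrt s / 4⌋₊ with hN_def
  have hN1 : 1 ≤ N := by omega
  have hN8' : 8 ≤ N := by omega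
  have hNpos : (0 : ℝ) < N := by exact_mod_cast (show 0 < N by omega)
  have hn1 : 1 ≤ n := by omega
  have hnL : n ≤ L := by omega
  have h4NL : 4 * N + 8 ≤ L := by omega
  have hsL2 : s ≤ (L : ℝ) ^ 2 := by
    have h1 : s ≤ (n : ℝ) ^ 2 := by nlinarith only [hsq, hceil, Real.sqrt_nonneg s]
    have h2 : (n : ℝ) ≤ L := by exact_mod_cast hnL
    have h3 : (0:ℝ) ≤ n := by positivity
    nlinarith only [h1, h2, h3]
  have hs1 : (1 : ℝ) ≤ s := by linarith only [hs]
  have hs4 : (4 : ℝ) ≤ s := by linarith only [hs]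
  /- ───── objects ───── -/
  set D := wilsonDirac (fundamentalRep (Fin 3)) U m 1 with hD
  set D₁ := wilsonDirac (fundamentalRep (Fin 3)) (freeCfg L) m 1 with hD₁
  set H := Dᴴ * D with hH
  set H₁ := D₁ᴴ * D₁ with hH₁
  -- the cutoff and its diagonal matrix
  set χ : TorusSite 4 L → ℝ := fun z => (∏ ν : Fin 4, (max 0 (1 - (max 0 ((min ((z - x) ν).val (L - ((z - x) ν).val) : ℝ) / ((⌊Real.sqrt s / 4⌋₊ : ℕ) : ℝ) - 1)) ^ 2)) ^ 2) with hχ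
  set d : TorusSite 4 L × Fin 3 × Fin 4 → ℂ := fun j => ((χ j.1 : ℝ) : ℂ) with hd
  set M := Matrix.diagonal d with hM
  obtain ⟨hχx, hχ01, hχ0, hχlip⟩ := hCut L x N hN1
  have hd1 : ∀ j, ‖d j‖ ≤ 1 := fun j => by
    rw [hd]; dsimp only
    rw [Complex.norm_real, Real.norm_eq_abs, abs_of_nonneg (hχ01 j.1).1]
    exact (hχ01 j.1).2
  -- the time weight
  set θ : ℝ → ℝ := fun τ => 1 - (4 * (s - τ) / (3 * s)) ^ 2 with hθ
  set θ' : ℝ → ℝ := fun τ => 32 / (9 * s ^ 2) * (s - τ) with hθ'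
  have hθs : θ s = 1 := by rw [hθ]; dsimp only; simp
  have hθq : θ (s / 4) = 0 := by rw [hθ]; dsimp only; field_simp; ring
  have hθ01 : ∀ τ ∈ Set.Icc (s / 4) s, 0 ≤ θ τ ∧ θ τ ≤ 1 := by
    intro τ hτ
    rw [hθ]; dsimp only
    have hu0 : 0 ≤ 4 * (s - τ) / (3 * s) := div_nonneg (by linarith only [hτ.2]) (by linarith only [hs0])
    have hu1 : 4 * (s - τ) / (3 * s) ≤ 1 := by
      rw [div_le_one (by linarith only [hs0])]; linarith only [hτ.1, hs0]
    have hsq' : (4 * (s - τ) / (3 * s)) ^ 2 ≤ 1 := by nlinarith only [hu0, hu1]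
    exact ⟨by linarith only [hsq'], by nlinarith only [hu0]⟩
  have hθ'0 : ∀ τ ∈ Set.Icc (s / 4) s, 0 ≤ θ' τ := by
    intro τ hτ; rw [hθ']; dsimp only
    have : 0 ≤ s - τ := by linarith only [hτ.2]
    positivity
  have hθ'le : ∀ τ ∈ Set.Icc (s / 4) s, θ' τ / (1 + (s - τ)) ≤ 32 / (9 * s ^ 2) := by
    intro τ hτ; rw [hθ']; dsimp only
    rw [div_le_iff₀ (by linarith only [hτ.2])]
    have : 0 ≤ 32 / (9 * s ^ 2) := by positivity
    nlinarith only [hτ.2, this]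
  /- ───── Duhamel ───── -/
  set i₀ : TorusSite 4 L × Fin 3 × Fin 4 := (x, a, α) with hi₀
  have hId := hDuh (TorusSite 4 L × Fin 3 × Fin 4) H₁ H M θ θ' (s / 4) s (by linarith)
    (fun τ _ => by rw [hθ, hθ']; exact hasDerivAt_timeWeight' hs0.ne' τ)
    (by rw [hθ']; exact (by fun_prop : Continuous fun τ : ℝ => 32 / (9 * s ^ 2) * (s - τ)).continuousOn) i₀
  -- the integrand and the represented row
  set F : ℝ → Matrix (TorusSite 4 L × Fin 3 × Fin 4) (TorusSite 4 L × Fin 3 × Fin 4) ℂ := fun τ =>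
    NormedSpace.exp (-((s - τ : ℝ) : ℂ) • H₁) * ((((θ τ : ℝ)) : ℂ) • (H₁ * M - M * H) + (((θ' τ : ℝ)) : ℂ) • M) *
      NormedSpace.exp (-(τ : ℂ) • H) with hF
  have hv : ∀ j, (NormedSpace.exp (-(s : ℂ) • H)) i₀ j = ∫ τ in (s / 4)..s, F τ i₀ j := by
    intro j
    have h := hId j
    rw [hθs, hθq] at h
    simp only [Complex.ofReal_one, one_mul, Complex.ofReal_zero, zero_mul, sub_zero] at h
    rw [← h, hM, hi₀, Matrix.diagonal_mul, hd]
    dsimp only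
    rw [hχ]; dsimp only
    rw [hχx, Complex.ofReal_one, one_mul]
  /- ───── constants of the bound ───── -/
  set lam : ℝ := 4 * κ / rs with hlam
  have hlam0 : 0 ≤ lam := by positivity
  have hlam2 : lam ^ 2 / 2 = 8 * κ ^ 2 / s := by
    rw [hlam, div_pow, mul_pow, hsq]; ring
  set Λ : ℝ := 96 * lam with hΛ
  have hΛ0 : 0 ≤ Λ := by positivity
  set Y : ℝ := 8 * B / s with hY
  have hY0 : 0 ≤ Y := by positivity
  set Z : ℝ := 8 * B / s * (2 / rs) with hZ
  have hrs0 : 0 < rs := by linarith only [hrs]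
  have hZ0 : 0 ≤ Z := by positivity
  -- flatness in the form consumed by the hopping lemma
  have hflat' : ∀ z : TorusSite 4 L, torusDist x z ≤ 128 * n → ∀ μ : Fin 4,
      3 - ((fundamentalRep (Fin 3)) (U (z, μ))).trace.re ≤ lam ^ 2 / 2 := by
    intro z hz μ; rw [hlam2]; exact hflat z hz μ
  -- γ₅ structure of `D`
  set Γ : Matrix (TorusSite 4 L × Fin 3 × Fin 4) (TorusSite 4 L × Fin 3 × Fin 4) ℂ := spinorLift gammaFive with hΓ
  have hΓ1 : Γ * D * Γ = Dᴴ :=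
    wilsonDirac_gammaFive_hermitian_holds (fundamentalRep (Fin 3)) fundamentalRep_mem_unitaryGroup U m 1
  have hΓ2 : Γ * Γ = 1 := spinorLift_gammaFive_mul_self
  have hΓ3 : ∀ i j, i ≠ j → Γ i j = 0 := by
    intro i j hij; rw [hΓ, spinorLift_gammaFive_eq_diagonal]; exact Matrix.diagonal_apply_ne _ hij
  have hΓ4 : ∀ i, ‖Γ i i‖ = 1 := by
    intro i; rw [hΓ, spinorLift_gammaFive_eq_diagonal, Matrix.diagonal_apply_eq]
    obtain ⟨z, b, β⟩ := i
    fin_cases β <;> simp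
  /- ───── support facts ───── -/
  have hsuppd : ∀ k : TorusSite 4 L × Fin 3 × Fin 4, d k ≠ 0 → torusDist x k.1 < 2 * N := by
    intro k hk
    by_contra hge
    push Not at hge
    apply hk
    rw [hd]; dsimp only
    rw [hχ]; dsimp only
    rw [hχ0 k.1 hge, Complex.ofReal_zero]
  have hsuppD₁ : ∀ k q : TorusSite 4 L × Fin 3 × Fin 4, D₁ k q ≠ 0 → torusDist k.1 q.1 ≤ 1 := by
    intro k q hkq
    by_contra hgt
    push Not at hgt
    exact hkq (wilsonDirac_apply_eq_zero _ _ m 1 k q hgt)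
  have hsuppE : ∀ k q : TorusSite 4 L × Fin 3 × Fin 4, (D - D₁) k q ≠ 0 → torusDist k.1 q.1 ≤ 1 := by
    intro k q hkq
    by_contra hgt
    push Not at hgt
    apply hkq
    have h1 := wilsonDirac_apply_eq_zero (fundamentalRep (Fin 3)) U m 1 k q hgt
    have h2 := wilsonDirac_apply_eq_zero (fundamentalRep (Fin 3)) (freeCfg L) m 1 k q hgt
    rw [Matrix.sub_apply]
    rw [← hD] at h1
    rw [← hD₁] at h2
    rw [h1, h2, sub_zero]
  have hN2n : 2 * N + 2 ≤ 64 * n := by omega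
  -- rows of `e^{-τH}` near the centre, via monotonicity down to time `s/8`
  have hrowP : ∀ (τ : ℝ), s / 8 ≤ τ → ∀ k' : TorusSite 4 L × Fin 3 × Fin 4, torusDist x k'.1 ≤ 64 * n →
      Real.sqrt (∑ j, ‖(NormedSpace.exp (-(τ : ℂ) • (Dᴴ * D))) k' j‖ ^ 2) ≤ Y := by
    intro τ hτ k' hk'
    obtain ⟨z, b, β⟩ := k'
    have hmono := hRow.2.1 _ D (z, b, β) (s / 8) τ (by positivity) hτ
    exact (Real.sqrt_le_sqrt hmono).trans (hher z b β hk')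
  -- rows of `D e^{-τH}` near the centre, via the `Q`-trick
  have hrowDP : ∀ (τ : ℝ), s / 4 ≤ τ → ∀ k' : TorusSite 4 L × Fin 3 × Fin 4, torusDist x k'.1 ≤ 64 * n →
      Real.sqrt (∑ j, ‖(D * NormedSpace.exp (-(τ : ℂ) • (Dᴴ * D))) k' j‖ ^ 2) ≤ Z := by
    intro τ hτ k' hk'
    have hτ0 : 0 < τ := by linarith only [hτ, hs0]
    have hQ := hRow.2.2 _ D Γ hΓ1 hΓ2 hΓ3 hΓ4 k' τ hτ0
    have hm' := hRow.2.1 _ D k' (s / 8) (τ / 2) (by positivity) (by linarith only [hτ])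
    have h8 := hher k'.1 k'.2.1 k'.2.2 hk'
    have hsq8 : ∑ j, ‖(NormedSpace.exp (-((s / 8 : ℝ) : ℂ) • (Dᴴ * D))) k' j‖ ^ 2 ≤ Y ^ 2 := by
      have h0 : 0 ≤ ∑ j, ‖(NormedSpace.exp (-((s / 8 : ℝ) : ℂ) • (Dᴴ * D))) k' j‖ ^ 2 :=
        Finset.sum_nonneg fun _ _ => by positivity
      calc _ = (Real.sqrt (∑ j, ‖(NormedSpace.exp (-((s / 8 : ℝ) : ℂ) • (Dᴴ * D))) k' j‖ ^ 2)) ^ 2 :=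
            (Real.sq_sqrt h0).symm
        _ ≤ Y ^ 2 := pow_le_pow_left₀ (Real.sqrt_nonneg _) h8 2
    have he : 1 / (Real.exp 1 * τ) ≤ 4 / s := by
      rw [div_le_div_iff₀ (by positivity) hs0]
      have h1e : 1 ≤ Real.exp 1 := Real.one_le_exp (by norm_num)
      nlinarith only [h1e, hτ, hτ0.le]
    have hZsq : Z ^ 2 = 4 / s * Y ^ 2 := by
      have hZY : Z = Y * (2 / rs) := by rw [hZ, hY]
      rw [hZY, mul_pow, div_pow (2:ℝ) rs, hsq]; ring
    have hbound : ∑ j, ‖(D * NormedSpace.exp (-(τ : ℂ) • (Dᴴ * D))) k' j‖ ^ 2 ≤ Z ^ 2 := by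
      rw [hZsq]
      calc _ ≤ 1 / (Real.exp 1 * τ) * ∑ j, ‖(NormedSpace.exp (-((τ / 2 : ℝ) : ℂ) • (Dᴴ * D))) k' j‖ ^ 2 := hQ
        _ ≤ 4 / s * Y ^ 2 := by
          refine mul_le_mul he (hm'.trans hsq8) (Finset.sum_nonneg fun _ _ => by positivity) (by positivity)
    calc Real.sqrt _ ≤ Real.sqrt (Z ^ 2) := Real.sqrt_le_sqrt hbound
      _ = Z := Real.sqrt_sq hZ0
  /- ───── the pointwise bound on the integrand row ───── -/
  have hpt : ∀ τ ∈ Set.Icc (s / 4) s, Real.sqrt (∑ j, ‖F τ i₀ j‖ ^ 2) ≤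
      (Cc / (N : ℝ) ^ 4 + 32 / (9 * s ^ 2) * Cr) +
        Λ * Y * (Cr * Real.exp (-(cr * (s - τ) * m ^ 2)) * (|m| + 32 / Real.sqrt (1 + (s - τ)) + 512 / (N : ℝ))) +
        Λ * Z * (Cr * Real.exp (-(cr * (s - τ) * m ^ 2))) := by
    intro τ hτ
    have hσ0 : 0 ≤ s - τ := by linarith only [hτ.2]
    have hσL : s - τ ≤ (L : ℝ) ^ 2 := by linarith only [hτ.1, hsL2, hs0]
    have hτ0 : 0 ≤ τ := by linarith only [hτ.1, hs0]
    obtain ⟨hθ0, hθ1⟩ := hθ01 τ hτ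
    have hθ'0' := hθ'0 τ hτ
    -- the free row facts at time `σ = s - τ`
    obtain ⟨hK2, hK1, hKΔ⟩ := hFR L m hm (s - τ) hσ0 hσL x a α
    set K := NormedSpace.exp (-((s - τ : ℝ) : ℂ) • (D₁ᴴ * D₁)) with hK
    set R₁ : ℝ := Cr * Real.exp (-(cr * (s - τ) * m ^ 2)) with hR₁
    have hR₁0 : 0 ≤ R₁ := by positivity
    -- h1
    have h1 : Real.sqrt (∑ j, ‖K i₀ j‖ ^ 2) ≤ Cr / (1 + (s - τ)) := by
      have := Real.sqrt_le_sqrt hK2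
      rwa [Real.sqrt_sq (div_nonneg hCr (by linarith only [hσ0]))] at this
    -- h3 (commutator)
    have h3 : Real.sqrt (∑ j, ‖(K * (D₁ᴴ * D₁ * M - M * (D₁ᴴ * D₁))) i₀ j‖ ^ 2) ≤ Cc / (N : ℝ) ^ 4 := by
      have hc := hComm L m hm (s - τ) hσ0 hσL x a α N hN8' h4NL
      have := Real.sqrt_le_sqrt hc
      rwa [Real.sqrt_sq (by positivity)] at this
    -- hS (smoothing row)
    have hS : ∑ k, ‖(K * M * D₁ᴴ) i₀ k‖ ≤ R₁ * (|m| + 32 / Real.sqrt (1 + (s - τ)) + 512 / (N : ℝ)) := by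
      have h := hSmooth L K χ i₀ N m R₁ (R₁ / Real.sqrt (1 + (s - τ))) hN1 hχ01 hχlip hK1 hKΔ
      refine h.trans (le_of_eq ?_)
      have : Real.sqrt (1 + (s - τ)) ≠ 0 := (Real.sqrt_pos.mpr (by linarith only [hσ0])).ne'
      field_simp
    -- hR
    have hRr : ∑ k, ‖(K * M) i₀ k‖ ≤ R₁ := by
      refine le_trans (Finset.sum_le_sum fun k _ => ?_) hK1
      rw [hM, Matrix.mul_diagonal, norm_mul]
      exact mul_le_of_le_one_right (norm_nonneg _) (hd1 k)
    -- supports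
    have hreg1 : ∀ k, (K * M * D₁ᴴ) i₀ k ≠ 0 → torusDist x k.1 ≤ 2 * N := by
      intro k hk
      obtain ⟨q, hq1, hq2⟩ := exists_of_mul_diagonal_mul_conjTranspose_ne_zero K D₁ d (by rw [← hM]; exact hk)
      have h1' := hsuppd q hq1
      have h2' := hsuppD₁ k q hq2
      have h3' := torusDist_triangle' x q.1 k.1
      rw [torusDist_comm' q.1 k.1] at h3'
      omega
    have hreg2 : ∀ k, (K * M) i₀ k ≠ 0 → torusDist x k.1 < 2 * N := fun k hk =>
      hsuppd k (ne_zero_of_mul_diagonal_ne_zero K d (by rw [← hM]; exact hk))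
    have hE : ∀ k, (K * M * D₁ᴴ) i₀ k ≠ 0 → ∑ k', ‖(D - D₁) k k'‖ ≤ Λ := by
      intro k hk
      have hk' : torusDist x k.1 + 1 ≤ 128 * n := by have := hreg1 k hk; omega
      exact (hHop L U m x (128 * n) lam hlam0 hflat' k hk').1
    have hP : ∀ k k', (K * M * D₁ᴴ) i₀ k ≠ 0 → (D - D₁) k k' ≠ 0 →
        Real.sqrt (∑ j, ‖(NormedSpace.exp (-(τ : ℂ) • (Dᴴ * D))) k' j‖ ^ 2) ≤ Y := by
      intro k k' hk hkk'
      refine hrowP τ (by linarith only [hτ.1, hs0]) k' ?_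
      have := hreg1 k hk; have := hsuppE k k' hkk'; have := torusDist_triangle' x k.1 k'.1; omega
    have hEH : ∀ k, (K * M) i₀ k ≠ 0 → ∑ k', ‖(D - D₁)ᴴ k k'‖ ≤ Λ := by
      intro k hk
      have hk' : torusDist x k.1 + 1 ≤ 128 * n := by have := hreg2 k hk; omega
      have h := (hHop L U m x (128 * n) lam hlam0 hflat' k hk').2
      refine le_trans (le_of_eq (Finset.sum_congr rfl fun k' _ => ?_)) h
      rw [Matrix.conjTranspose_apply, norm_star]
    have hDP : ∀ k k', (K * M) i₀ k ≠ 0 → (D - D₁)ᴴ k k' ≠ 0 →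
        Real.sqrt (∑ j, ‖(D * NormedSpace.exp (-(τ : ℂ) • (Dᴴ * D))) k' j‖ ^ 2) ≤ Z := by
      intro k k' hk hkk'
      refine hrowDP τ hτ.1 k' ?_
      have h1' := hreg2 k hk
      have h2' : (D - D₁) k' k ≠ 0 := by
        intro h0; apply hkk'; rw [Matrix.conjTranspose_apply, h0, star_zero]
      have := hsuppE k' k h2'; have := torusDist_triangle' x k.1 k'.1; rw [torusDist_comm' k.1 k'.1] at this
      omega
    -- assemble
    have hmain := hIntegrand _ hRow.1 K D D₁ d hd1 τ (θ τ) (θ' τ) hτ0 hθ0 hθ'0' i₀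
      (Cr / (1 + (s - τ))) (Cc / (N : ℝ) ^ 4) (R₁ * (|m| + 32 / Real.sqrt (1 + (s - τ)) + 512 / (N : ℝ))) R₁ Λ Y Z
      hΛ0 hY0 hZ0 h1 h3 hS hRr hE hP hEH hDP
    have hFτ : F τ = K * (((θ τ : ℝ) : ℂ) • (D₁ᴴ * D₁ * Matrix.diagonal d - Matrix.diagonal d * (Dᴴ * D)) +
        ((θ' τ : ℝ) : ℂ) • Matrix.diagonal d) * NormedSpace.exp (-(τ : ℂ) • (Dᴴ * D)) := by
      rw [hF]
    rw [hFτ]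
    refine hmain.trans ?_
    -- `θ ≤ 1`, `θ' R₂ ≤ 32 Cr/(9 s²)`
    have hQ0 : 0 ≤ Cc / (N : ℝ) ^ 4 := by positivity
    have hSS0 : 0 ≤ R₁ * (|m| + 32 / Real.sqrt (1 + (s - τ)) + 512 / (N : ℝ)) := by positivity
    have hθ'R : θ' τ * (Cr / (1 + (s - τ))) ≤ 32 / (9 * s ^ 2) * Cr := by
      have := hθ'le τ hτ
      rw [show θ' τ * (Cr / (1 + (s - τ))) = (θ' τ / (1 + (s - τ))) * Cr by ring]
      exact mul_le_mul_of_nonneg_right this hCr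
    have e1 : θ τ * (Cc / (N : ℝ) ^ 4) ≤ Cc / (N : ℝ) ^ 4 := by nlinarith only [hθ0, hθ1, hQ0]
    have e2 : θ τ * (R₁ * (|m| + 32 / Real.sqrt (1 + (s - τ)) + 512 / (N : ℝ))) * Λ * Y ≤
        Λ * Y * (R₁ * (|m| + 32 / Real.sqrt (1 + (s - τ)) + 512 / (N : ℝ))) := by
      have : θ τ * (R₁ * (|m| + 32 / Real.sqrt (1 + (s - τ)) + 512 / (N : ℝ))) * Λ * Y =
          θ τ * (Λ * Y * (R₁ * (|m| + 32 / Real.sqrt (1 + (s - τ)) + 512 / (N : ℝ)))) := by ring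
      rw [this]
      have h0 : 0 ≤ Λ * Y * (R₁ * (|m| + 32 / Real.sqrt (1 + (s - τ)) + 512 / (N : ℝ))) := by positivity
      nlinarith only [hθ0, hθ1, h0]
    have e3 : θ τ * R₁ * Λ * Z ≤ Λ * Z * R₁ := by
      have : θ τ * R₁ * Λ * Z = θ τ * (Λ * Z * R₁) := by ring
      rw [this]
      have h0 : 0 ≤ Λ * Z * R₁ := by positivity
      nlinarith only [hθ0, hθ1, h0]
    rw [hR₁] at e2 e3 ⊢
    linarith only [e1, e2, e3, hθ'R]
  /- ───── continuity and duality ───── -/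
  have hθc : Continuous θ := by rw [hθ]; fun_prop
  have hθ'c : Continuous θ' := by rw [hθ']; fun_prop
  have hFc : ∀ j, ContinuousOn (fun τ => F τ i₀ j) (Set.Icc (s / 4) s) := fun j => by
    rw [hF]
    exact rowDuhamel_continuousOn_entry (D₁ᴴ * D₁) (Dᴴ * D) M s hθc.continuousOn hθ'c.continuousOn i₀ j
  set G : ℝ → ℝ := fun τ => (Cc / (N : ℝ) ^ 4 + 32 / (9 * s ^ 2) * Cr) +
        Λ * Y * (Cr * Real.exp (-(cr * (s - τ) * m ^ 2)) * (|m| + 32 / Real.sqrt (1 + (s - τ)) + 512 / (N : ℝ))) +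
        Λ * Z * (Cr * Real.exp (-(cr * (s - τ) * m ^ 2))) with hG
  have hGc : ContinuousOn G (Set.Icc (s / 4) s) := by
    rw [hG]; exact continuousOn_boundFn _ _ _ Cr cr m (N : ℝ) s
  have hdual := hDual _ (fun j => (NormedSpace.exp (-(s : ℂ) • (Dᴴ * D))) i₀ j) (fun τ j => F τ i₀ j) G (s / 4) s
    (by linarith only [hs0]) hFc hGc hv (fun τ hτ => by rw [hG]; exact hpt τ hτ)
  /- ───── the integral of `G` ───── -/
  have hIG : (∫ τ in (s / 4)..s, G τ) ≤ 3 * s / 4 * (Cc / (N : ℝ) ^ 4 + 32 / (9 * s ^ 2) * Cr) +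
      Λ * Y * (Cr * (Real.sqrt s / Real.sqrt cr + 64 * Real.sqrt s + 384 * s / (N : ℝ))) +
        Λ * Z * (Cr * (3 * s / 4)) := by
    rw [hG]
    exact integral_boundFn_le hInt hs4 hcr hCr (by positivity) (by positivity) hNpos
  /- ───── final arithmetic ───── -/
  have hstep : s * Real.sqrt (∑ j, ‖(NormedSpace.exp (-(s : ℂ) • (Dᴴ * D))) i₀ j‖ ^ 2) ≤
      s * (3 * s / 4 * (Cc / (N : ℝ) ^ 4 + 32 / (9 * s ^ 2) * Cr) +
        Λ * Y * (Cr * (Real.sqrt s / Real.sqrt cr + 64 * Real.sqrt s + 384 * s / (N : ℝ))) +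
          Λ * Z * (Cr * (3 * s / 4))) :=
    mul_le_mul_of_nonneg_left (hdual.trans hIG) hs0.le
  refine hstep.trans ?_
  rw [hΛ, hY, hZ, hlam]
  exact final_arith hs0 hrs0 hsq hN8 hNpos hCr hCc hκ.le hB

end Summit.QuantumFields.QCD.Cruxes.SmallFieldUltracontractivity.PointCentredAxialParabolic

end
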